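import Summits.HubbardSuperconductivity.HubbardSuperconductivity.Theses.FunctionFieldCertificate
import Summits.HubbardSuperconductivity.HubbardSuperconductivity.Theorems.FunctionFieldCertificateMesoscopicPairOrderStubBoxExpectation
import Summits.HubbardSuperconductivity.HubbardSuperconductivity.Theorems.FunctionFieldCertificateMesoscopicPairOrderBlochAbstract
import Literature.MathematicalPhysics.QuantumLattice.FockRelabel
import HarnessLib

/-!
# Crux `MesoscopicPairOrder` (stmt-HubbardSuperconductivity-7331), line `Sketch`:
# Bloch reduction — only translation-covariant ground states need to be checked

Support file for the crux (route `FunctionFieldCertificate`, pole-free half; lead c2 of line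
`Sketch`). The crux asks for a margin `m R² ≤ T_R(ψ)/L²` of the Fejér-box pair functional
`T_R(ψ) = Σ_{x,y} W_R(y - x) Re⟨P_x ψ, P_y ψ⟩` in EVERY normalised `(N_L, S^z = 0)`-sector ground
state `ψ` of `H_L = hubbardTorus 2 L 1 U` — including every superposition inside a degenerate
ground eigenspace. This file discharges the degeneracy bookkeeping against the lattice
translations `U_v = fockTranslate v`:

* §1 (abstract, model-free). For a Hermitian matrix `A`, a subspace `K` containing a unit vector,
  and two commuting matrices `T₁, T₂` commuting with `A` and preserving `K` together with their
  adjoints, the minimum of the Rayleigh quotient `Re⟨φ, A φ⟩` over the unit vectors of `K` is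
  attained at a COMMON EIGENVECTOR of `T₁` and `T₂`
  (`exists_unit_common_eigenvector_isMinOn`). Ingredients: the minimum is attained (compactness,
  `exists_isMinOn_re_rayleigh`); a minimiser `φ₀` is a weak eigenvector,
  `⟨ψ, A φ₀⟩ = μ ⟨ψ, φ₀⟩` for all `ψ ∈ K` (first variation, `dotProduct_mulVec_eq_of_isMinOn`);
  the weak eigenspace is a nonzero subspace invariant under `T₁, T₂`; two commuting matrices have
  a common eigenvector in any nonzero jointly invariant subspace (`exists_common_eigenvector_mem`,
  from Mathlib's `Module.End.exists_eigenvalue` over `ℂ`).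
* §2 (the torus). The box pair repulsion `K_R = Σ_{x,y} W_R(y - x) • (P_xᴴ P_y)` (inline, as in
  the line's skeleton) is Hermitian and translation invariant; the sector ground eigenspace is
  invariant under every `U_v`; a joint eigenvector of the two unit translations is an eigenvector
  of every `U_v`; and in such a BLOCH vector the pair correlation `⟨P_x ψ, P_y ψ⟩` depends on
  `y - x` only (`corr_add_eq_of_bloch`), so that `T_R(ψ) = L² Σ_z W_R(z) Re⟨P_0 ψ, P_z ψ⟩`
  (`boxCorr_eq_card_mul_of_bloch`).
* §3 `mesoscopicPairOrder_iff_bloch`: **the crux is equivalent to its restriction to Bloch ground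
  states** (normalised sector ground states that are eigenvectors of every lattice translation),
  with the SAME `(U, δ, m, R, L₀)`. So a proof may assume translation-covariance of `ψ` (a genuine
  correlation FUNCTION `C_ψ(z) = Re⟨P_0 ψ, P_z ψ⟩` with `T_R(ψ)/L² = Σ_z W_R(z) C_ψ(z)`), and a
  refutation must exhibit LOW `T_R` on a Bloch ground state; superpositions across momenta never
  matter. This is the `fockTranslate` bookkeeping step named as missing glue by the previous leads
  (Lines/Sketch.md) and by card `Ideas/window-stationarity-box-transfer.md` (ii).

H. Tasaki, *Physics and Mathematics of Quantum Many-Body Systems* (2020) §2.1 (variational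
principle), §4.1 (translation invariance, momentum eigenstates); T. Kato, *Perturbation Theory for
Linear Operators* (1966) I §6; folklore (commuting normal operators have common eigenvectors). No
definition is introduced.
-/

noncomputable section

-- the summit namespace `Summit.HubbardSuperconductivity.HubbardSuperconductivity.…` repeats the problem name by design (D-0017)
set_option linter.dupNamespace false

namespace Summit.HubbardSuperconductivity.HubbardSuperconductivity.Theorems.FunctionFieldCertificate

open Matrix Finset Filter
open Literature.Probability.LatticeModels Literature.MathematicalPhysics.QuantumLattice
open Summit.HubbardSuperconductivity.HubbardSuperconductivity.Theses.FunctionFieldCertificate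
open scoped ComplexOrder

/-! ### §2 The torus: translations, the box pair repulsion, Bloch vectors -/

section Torus

variable {L : ℕ} [NeZero L]

omit [NeZero L] in
/-- The tent weight `W_R(y - x)` is symmetric: `W_R(x - y) = W_R(y - x)`
(`|(-a).valMinAbs| = |a.valMinAbs|` in `ℤ/Lℤ`). [folklore] -/
theorem fejerWeight_symm (R : ℕ) (x y : TorusSite 2 L) :
    (∏ i : Fin 2, max 0 (1 - |(((x i - y i).valMinAbs : ℤ) : ℝ)| / (R : ℝ))) =
      ∏ i : Fin 2, max 0 (1 - |(((y i - x i).valMinAbs : ℤ) : ℝ)| / (R : ℝ)) := by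
  refine Finset.prod_congr rfl fun i _ => ?_
  rw [← neg_sub (y i) (x i), ← Int.cast_abs, ← Int.cast_abs, Int.abs_eq_natAbs,
    Int.abs_eq_natAbs, ZMod.natAbs_valMinAbs_neg]

omit [NeZero L] in
/-- The tent weight is translation invariant: `W_R((y + v) - (x + v)) = W_R(y - x)`. [folklore] -/
theorem fejerWeight_add_right (R : ℕ) (x y v : TorusSite 2 L) :
    (∏ i : Fin 2, max 0 (1 - |((((y + v) i - (x + v) i).valMinAbs : ℤ) : ℝ)| / (R : ℝ))) =
      ∏ i : Fin 2, max 0 (1 - |(((y i - x i).valMinAbs : ℤ) : ℝ)| / (R : ℝ)) := by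
  refine Finset.prod_congr rfl fun i _ => ?_
  rw [Pi.add_apply, Pi.add_apply, add_sub_add_right_eq_sub]

/-- **The box pair repulsion `K_R = Σ_{x,y} W_R(y - x) • (P_xᴴ P_y)` is Hermitian** (real
symmetric weight). [folklore] -/
theorem isHermitian_boxRepulsion (R : ℕ) :
    (∑ x : TorusSite 2 L, ∑ y : TorusSite 2 L,
      ((∏ i : Fin 2, max 0 (1 - |(((y i - x i).valMinAbs : ℤ) : ℝ)| / (R : ℝ)) : ℝ) : ℂ) •
        ((localPair dWaveFormFactor L x)ᴴ * localPair dWaveFormFactor L y)).IsHermitian := by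
  unfold Matrix.IsHermitian
  rw [conjTranspose_sum]
  simp_rw [conjTranspose_sum, conjTranspose_smul, conjTranspose_mul, conjTranspose_conjTranspose,
    Complex.star_def, Complex.conj_ofReal]
  rw [Finset.sum_comm]
  refine Finset.sum_congr rfl fun x _ => Finset.sum_congr rfl fun y _ => ?_
  rw [fejerWeight_symm]

/-- **`K_R` is translation invariant**: `T_v K_R T_v⁻¹ = K_R` (`T_v P_x T_v⁻¹ = P_{x+v}` and the
weight depends on `y - x` only). [folklore] -/
theorem relabel_translate_boxRepulsion (R : ℕ) (v : TorusSite 2 L) :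
    relabel (Orb.translate v) (∑ x : TorusSite 2 L, ∑ y : TorusSite 2 L,
      ((∏ i : Fin 2, max 0 (1 - |(((y i - x i).valMinAbs : ℤ) : ℝ)| / (R : ℝ)) : ℝ) : ℂ) •
        ((localPair dWaveFormFactor L x)ᴴ * localPair dWaveFormFactor L y)) =
      ∑ x : TorusSite 2 L, ∑ y : TorusSite 2 L,
        ((∏ i : Fin 2, max 0 (1 - |(((y i - x i).valMinAbs : ℤ) : ℝ)| / (R : ℝ)) : ℝ) : ℂ) •
          ((localPair dWaveFormFactor L x)ᴴ * localPair dWaveFormFactor L y) := by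
  rw [relabel_sum]
  simp_rw [relabel_sum, relabel_smul, relabel_mul, relabel_conjTranspose, relabel_translate_localPair]
  -- reindex `x ↦ x + v`, `y ↦ y + v`
  refine Fintype.sum_equiv (Equiv.addRight v) _ _ fun x => ?_
  refine Fintype.sum_equiv (Equiv.addRight v) _ _ fun y => ?_
  simp only [Equiv.coe_addRight]
  rw [fejerWeight_add_right]

/-- `[T_v, K_R] = 0`. [folklore] -/
theorem fockTranslate_commute_boxRepulsion (R : ℕ) (v : TorusSite 2 L) :
    Commute (fockTranslate v).val (∑ x : TorusSite 2 L, ∑ y : TorusSite 2 L,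
      ((∏ i : Fin 2, max 0 (1 - |(((y i - x i).valMinAbs : ℤ) : ℝ)| / (R : ℝ)) : ℝ) : ℂ) •
        ((localPair dWaveFormFactor L x)ᴴ * localPair dWaveFormFactor L y)) :=
  fockRelabel_commute_of_relabel_eq _ (relabel_translate_boxRepulsion R v)

/-- `T_{v+w} = T_v T_w` on matrices. [folklore] -/
theorem fockTranslate_add_val (v w : TorusSite 2 L) :
    (fockTranslate (v + w)).val = (fockTranslate v).val * (fockTranslate w).val := by
  rw [fockTranslate_add]
  rfl

/-- `T_vᴴ = T_{-v}` on matrices. [folklore] -/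
theorem conjTranspose_fockTranslate_val (v : TorusSite 2 L) :
    ((fockTranslate v).val)ᴴ = (fockTranslate (-v)).val := by
  rw [fockTranslate_neg]
  rfl

/-- **The sector ground eigenspace is translation invariant**: if `ψ ∈ szSector N M` and
`H_L ψ = E ψ` (`H_L = hubbardTorus 2 L t U`), the same holds for `T_v ψ`. [folklore] -/
theorem fockTranslate_mulVec_mem_ground (t U : ℝ) (N : ℕ) (M : ℝ) (E : ℂ) (v : TorusSite 2 L)
    {ψ : Fock (Orb (FermionTorus 2 L))} (hψ : ψ ∈ szSector (Λ := FermionTorus 2 L) N M)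
    (hE : hubbardTorus 2 L t U *ᵥ ψ = E • ψ) :
    (fockTranslate v).val *ᵥ ψ ∈ szSector (Λ := FermionTorus 2 L) N M ∧
      hubbardTorus 2 L t U *ᵥ ((fockTranslate v).val *ᵥ ψ) = E • ((fockTranslate v).val *ᵥ ψ) := by
  refine ⟨fockTranslate_mulVec_mem_szSector v hψ, ?_⟩
  rw [mulVec_mulVec, ← (fockTranslate_commute_hubbardTorus v t U).eq, ← mulVec_mulVec, hE,
    mulVec_smul]

/-- **A joint eigenvector of the two unit translations is an eigenvector of every translation**
(`(ℤ/Lℤ)²` is generated by `e₁, e₂`; eigenvectors of `T_v` and `T_w` are eigenvectors of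
`T_{v+w} = T_v T_w`). [folklore] -/
theorem forall_fockTranslate_mulVec_eq_smul_of_generators {ψ : Fock (Orb (FermionTorus 2 L))}
    (h₁ : ∃ c : ℂ, (fockTranslate (Pi.single 0 1 : TorusSite 2 L)).val *ᵥ ψ = c • ψ)
    (h₂ : ∃ c : ℂ, (fockTranslate (Pi.single 1 1 : TorusSite 2 L)).val *ᵥ ψ = c • ψ) :
    ∀ v : TorusSite 2 L, ∃ c : ℂ, (fockTranslate v).val *ᵥ ψ = c • ψ := by
  -- the set of good `v` contains `0` and is closed under addition
  have hzero : ∃ c : ℂ, (fockTranslate (0 : TorusSite 2 L)).val *ᵥ ψ = c • ψ :=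
    ⟨1, by rw [one_smul]; simp [fockTranslate_zero]⟩
  have hadd : ∀ v w : TorusSite 2 L, (∃ c : ℂ, (fockTranslate v).val *ᵥ ψ = c • ψ) →
      (∃ c : ℂ, (fockTranslate w).val *ᵥ ψ = c • ψ) →
        ∃ c : ℂ, (fockTranslate (v + w)).val *ᵥ ψ = c • ψ := by
    rintro v w ⟨c, hc⟩ ⟨d, hd⟩
    refine ⟨d * c, ?_⟩
    rw [fockTranslate_add_val, ← mulVec_mulVec, hd, mulVec_smul, hc, smul_smul]
  have hsmul : ∀ (k : ℕ) (v : TorusSite 2 L), (∃ c : ℂ, (fockTranslate v).val *ᵥ ψ = c • ψ) →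
      ∃ c : ℂ, (fockTranslate (k • v)).val *ᵥ ψ = c • ψ := by
    intro k v hv
    induction k with
    | zero => rwa [zero_smul]
    | succ k ih => rw [succ_nsmul]; exact hadd _ _ ih hv
  intro v
  have hv : v = (v 0).val • (Pi.single 0 1 : TorusSite 2 L) + (v 1).val • (Pi.single 1 1 : TorusSite 2 L) := by
    funext i
    rw [Pi.add_apply, Pi.smul_apply, Pi.smul_apply]
    fin_cases i <;> simp [ZMod.natCast_val, ZMod.cast_id']
  rw [hv]
  exact hadd _ _ (hsmul _ _ h₁) (hsmul _ _ h₂)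

/-- A translation eigenvalue on a nonzero vector is a phase: `|c|² = 1` (`T_v` is unitary). [folklore] -/
theorem normSq_eq_one_of_fockTranslate_mulVec_eq_smul (v : TorusSite 2 L)
    {ψ : Fock (Orb (FermionTorus 2 L))} (hψ : ψ ≠ 0) {c : ℂ}
    (hc : (fockTranslate v).val *ᵥ ψ = c • ψ) : ‖c‖ ^ 2 = 1 := by
  have h := star_fockRelabel_mulVec_dotProduct (Orb.translate v) ψ
  change star ((fockTranslate v).val *ᵥ ψ) ⬝ᵥ ((fockTranslate v).val *ᵥ ψ) = star ψ ⬝ᵥ ψ at h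
  rw [hc, star_smul, smul_dotProduct, dotProduct_smul, smul_smul, Complex.star_def,
    Complex.conj_mul', smul_eq_mul] at h
  have hpos : 0 < star ψ ⬝ᵥ ψ := dotProduct_star_self_pos_iff.2 hψ
  have hne : star ψ ⬝ᵥ ψ ≠ 0 := hpos.ne'
  have h2 : ((‖c‖ ^ 2 : ℝ) : ℂ) = 1 := by
    have := mul_right_cancel₀ hne (h.trans (one_mul _).symm)
    exact_mod_cast this
  exact_mod_cast h2

/-- **Expectations in a Bloch vector are translation invariant**: `⟨ψ, (T_v A T_v⁻¹) ψ⟩ = ⟨ψ, A ψ⟩`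
for EVERY matrix `A` whenever `T_v ψ = c ψ` (`|c| = 1`; `⟨T_v ψ, (T_v A T_v⁻¹) T_v ψ⟩ = ⟨ψ, A ψ⟩`).
This is constraint (T) "translation consistency" of card `window-stationarity-box-transfer` for
pure Bloch states. [folklore] -/
theorem expect_relabel_translate_of_bloch (v : TorusSite 2 L)
    (A : Matrix (Finset (Orb (FermionTorus 2 L))) (Finset (Orb (FermionTorus 2 L))) ℂ)
    {ψ : Fock (Orb (FermionTorus 2 L))} (hc : ∃ c : ℂ, (fockTranslate v).val *ᵥ ψ = c • ψ) :
    star ψ ⬝ᵥ relabel (Orb.translate v) A *ᵥ ψ = star ψ ⬝ᵥ A *ᵥ ψ := by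
  by_cases hψ : ψ = 0
  · simp [hψ]
  obtain ⟨c, hc⟩ := hc
  have hn := normSq_eq_one_of_fockTranslate_mulVec_eq_smul v hψ hc
  have h := expect_relabel_fockRelabel_mulVec (Orb.translate v) A ψ
  change star ((fockTranslate v).val *ᵥ ψ) ⬝ᵥ (relabel (Orb.translate v) A *ᵥ ((fockTranslate v).val *ᵥ ψ)) =
    star ψ ⬝ᵥ (A *ᵥ ψ) at h
  rw [hc, mulVec_smul, star_smul, smul_dotProduct, dotProduct_smul, smul_smul, Complex.star_def,
    Complex.conj_mul', smul_eq_mul, ← Complex.ofReal_pow, hn, Complex.ofReal_one, one_mul] at h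
  exact h

/-- **Pair correlations of a Bloch vector are translation invariant**:
`⟨P_{x+v} ψ, P_{y+v} ψ⟩ = ⟨P_x ψ, P_y ψ⟩` whenever `T_v ψ = c ψ`. [folklore] -/
theorem corr_add_eq_of_bloch (g : Site 2 → ℝ) (v x y : TorusSite 2 L)
    {ψ : Fock (Orb (FermionTorus 2 L))} (hc : ∃ c : ℂ, (fockTranslate v).val *ᵥ ψ = c • ψ) :
    star (localPair g L (x + v) *ᵥ ψ) ⬝ᵥ (localPair g L (y + v) *ᵥ ψ) =
      star (localPair g L x *ᵥ ψ) ⬝ᵥ (localPair g L y *ᵥ ψ) := by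
  have h := expect_relabel_translate_of_bloch v ((localPair g L x)ᴴ * localPair g L y) hc
  rwa [relabel_mul, relabel_conjTranspose, relabel_translate_localPair, relabel_translate_localPair,
    star_dotProduct_conjTranspose_mul_mulVec, star_dotProduct_conjTranspose_mul_mulVec] at h

/-- **In a Bloch vector the box functional is `L²` times a correlation-function sum**:
`T_R(ψ) = L² Σ_z W_R(z) Re⟨P_0 ψ, P_z ψ⟩`. [folklore] -/
theorem boxCorr_eq_card_mul_of_bloch (g : Site 2 → ℝ) (R : ℕ) {ψ : Fock (Orb (FermionTorus 2 L))}
    (hψ : ∀ v : TorusSite 2 L, ∃ c : ℂ, (fockTranslate v).val *ᵥ ψ = c • ψ) :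
    ∑ x : TorusSite 2 L, ∑ y : TorusSite 2 L,
        (∏ i : Fin 2, max 0 (1 - |(((y i - x i).valMinAbs : ℤ) : ℝ)| / (R : ℝ))) *
          (star (localPair g L x *ᵥ ψ) ⬝ᵥ (localPair g L y *ᵥ ψ)).re =
      (L : ℝ) ^ 2 * ∑ z : TorusSite 2 L,
        (∏ i : Fin 2, max 0 (1 - |(((z i - (0 : TorusSite 2 L) i).valMinAbs : ℤ) : ℝ)| / (R : ℝ))) *
          (star (localPair g L 0 *ᵥ ψ) ⬝ᵥ (localPair g L z *ᵥ ψ)).re := by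
  have hinner : ∀ x : TorusSite 2 L,
      ∑ y : TorusSite 2 L, (∏ i : Fin 2, max 0 (1 - |(((y i - x i).valMinAbs : ℤ) : ℝ)| / (R : ℝ))) *
          (star (localPair g L x *ᵥ ψ) ⬝ᵥ (localPair g L y *ᵥ ψ)).re =
        ∑ z : TorusSite 2 L,
          (∏ i : Fin 2, max 0 (1 - |(((z i - (0 : TorusSite 2 L) i).valMinAbs : ℤ) : ℝ)| / (R : ℝ))) *
            (star (localPair g L 0 *ᵥ ψ) ⬝ᵥ (localPair g L z *ᵥ ψ)).re := by
    intro x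
    symm
    refine Fintype.sum_equiv (Equiv.addRight x) _ _ fun z => ?_
    simp only [Equiv.coe_addRight]
    have hw : (∏ i : Fin 2, max 0 (1 - |((((z + x) i - x i).valMinAbs : ℤ) : ℝ)| / (R : ℝ))) =
        ∏ i : Fin 2, max 0 (1 - |(((z i - (0 : TorusSite 2 L) i).valMinAbs : ℤ) : ℝ)| / (R : ℝ)) := by
      refine Finset.prod_congr rfl fun i _ => ?_
      rw [Pi.add_apply, Pi.zero_apply, sub_zero, add_sub_cancel_right]
    rw [← corr_add_eq_of_bloch g x 0 z (hψ x), zero_add, hw]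
  simp_rw [hinner]
  rw [Finset.sum_const, Finset.card_univ, Fintype.card_fun, ZMod.card, Fintype.card_fin,
    nsmul_eq_mul, Nat.cast_pow]

end Torus

/-! ### §3 The crux needs Bloch ground states only -/

/-- **Bloch reduction of the every-ground-state quantifier, at fixed data.** If on the torus of
side `L` every normalised `(N, S^z = M)`-sector ground state of `hubbardTorus 2 L t U` that is an
eigenvector of EVERY lattice translation `T_v` has `b ≤ T_R(ψ)` (Fejér-box functional with form
factor `dWaveFormFactor`), then so does every normalised sector ground state. Proof: the sector
ground eigenspace `G` is invariant under the translations and their adjoints, `K_R` is Hermitian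
and commutes with them, so by `exists_unit_common_eigenvector_isMinOn` the minimum of
`Re⟨φ, K_R φ⟩ = T_R(φ)` over the unit vectors of `G` is attained at a joint eigenvector of
`T_{e₁}, T_{e₂}`, hence of every `T_v`. Tasaki (2020) §2.1, §4.1. [folklore] -/
theorem forall_ground_of_forall_bloch_ground (L : ℕ) [NeZero L] (t U : ℝ) (N : ℕ) (M : ℝ) (R : ℕ)
    (b : ℝ)
    (h : ∀ ψ : Fock (Orb (FermionTorus 2 L)), star ψ ⬝ᵥ ψ = 1 →
      IsGroundStateInSector (hubbardTorus 2 L t U) N M ψ →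
        (∀ v : TorusSite 2 L, ∃ c : ℂ, (fockTranslate v).val *ᵥ ψ = c • ψ) →
          b ≤ ∑ x : TorusSite 2 L, ∑ y : TorusSite 2 L,
            (∏ i : Fin 2, max 0 (1 - |(((y i - x i).valMinAbs : ℤ) : ℝ)| / (R : ℝ))) *
              (star (localPair dWaveFormFactor L x *ᵥ ψ) ⬝ᵥ (localPair dWaveFormFactor L y *ᵥ ψ)).re)
    (ψ : Fock (Orb (FermionTorus 2 L))) (hψ : star ψ ⬝ᵥ ψ = 1)
    (hgs : IsGroundStateInSector (hubbardTorus 2 L t U) N M ψ) :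
    b ≤ ∑ x : TorusSite 2 L, ∑ y : TorusSite 2 L,
      (∏ i : Fin 2, max 0 (1 - |(((y i - x i).valMinAbs : ℤ) : ℝ)| / (R : ℝ))) *
        (star (localPair dWaveFormFactor L x *ᵥ ψ) ⬝ᵥ (localPair dWaveFormFactor L y *ᵥ ψ)).re := by
  set H := hubbardTorus 2 L t U with hH
  set E : ℂ := ((H.minEnergyOn (szSector (Λ := FermionTorus 2 L) N M) : ℝ) : ℂ) with hEdef
  -- the sector ground eigenspace
  set G : Submodule ℂ (Fock (Orb (FermionTorus 2 L))) :=
    szSector (Λ := FermionTorus 2 L) N M ⊓ Module.End.eigenspace (Matrix.toLin' H) E with hG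
  have hmemG : ∀ φ : Fock (Orb (FermionTorus 2 L)),
      φ ∈ G ↔ φ ∈ szSector (Λ := FermionTorus 2 L) N M ∧ H *ᵥ φ = E • φ := fun φ => by
    rw [hG, Submodule.mem_inf, Module.End.mem_eigenspace_iff, Matrix.toLin'_apply]
  have hψG : ψ ∈ G := (hmemG ψ).2 ⟨hgs.1, hgs.2.2⟩
  -- the box pair repulsion
  set A : Matrix (Finset (Orb (FermionTorus 2 L))) (Finset (Orb (FermionTorus 2 L))) ℂ :=
    ∑ x : TorusSite 2 L, ∑ y : TorusSite 2 L,
      ((∏ i : Fin 2, max 0 (1 - |(((y i - x i).valMinAbs : ℤ) : ℝ)| / (R : ℝ)) : ℝ) : ℂ) •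
        ((localPair dWaveFormFactor L x)ᴴ * localPair dWaveFormFactor L y) with hA
  have hAH : A.IsHermitian := isHermitian_boxRepulsion R
  set T₁ := (fockTranslate (Pi.single 0 1 : TorusSite 2 L)).val with hT₁
  set T₂ := (fockTranslate (Pi.single 1 1 : TorusSite 2 L)).val with hT₂
  have h12 : Commute T₁ T₂ := by
    change (fockTranslate (Pi.single 0 1 : TorusSite 2 L)).val * (fockTranslate (Pi.single 1 1 : TorusSite 2 L)).val =
      (fockTranslate (Pi.single 1 1 : TorusSite 2 L)).val * (fockTranslate (Pi.single 0 1 : TorusSite 2 L)).val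
    rw [← fockTranslate_add_val, ← fockTranslate_add_val, add_comm]
  have hGinv : ∀ v : TorusSite 2 L, ∀ φ ∈ G, (fockTranslate v).val *ᵥ φ ∈ G := by
    intro v φ hφ
    obtain ⟨hφS, hφE⟩ := (hmemG φ).1 hφ
    exact (hmemG _).2 (fockTranslate_mulVec_mem_ground t U N M E v hφS hφE)
  have hGinv' : ∀ v : TorusSite 2 L, ∀ φ ∈ G, ((fockTranslate v).val)ᴴ *ᵥ φ ∈ G := by
    intro v φ hφ
    rw [conjTranspose_fockTranslate_val]
    exact hGinv (-v) φ hφ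
  obtain ⟨φ, hφG, hφ1, hc₁, hc₂, hmin⟩ := exists_unit_common_eigenvector_isMinOn hAH G ⟨ψ, hψG, hψ⟩
    h12 (fockTranslate_commute_boxRepulsion R _) (fockTranslate_commute_boxRepulsion R _)
    (hGinv _) (hGinv' _) (hGinv _) (hGinv' _)
  -- `φ` is a Bloch ground state
  have hbloch := forall_fockTranslate_mulVec_eq_smul_of_generators hc₁ hc₂
  obtain ⟨hφS, hφE⟩ := (hmemG φ).1 hφG
  have hφ0 : φ ≠ 0 := by
    intro h0
    rw [h0, star_zero, zero_dotProduct] at hφ1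
    exact zero_ne_one hφ1
  have hφgs : IsGroundStateInSector H N M φ := ⟨hφS, hφ0, hφE⟩
  have hbφ := h φ hφ1 hφgs hbloch
  have hle := hmin ψ hψG hψ
  rw [stub_boxExpectation L R φ, stub_boxExpectation L R ψ] at hle
  exact hbφ.trans hle

/-- **Bloch reduction of the crux.** `MesoscopicPairOrder` is equivalent to the same statement
with the ground states restricted to BLOCH ground states — normalised `(N_L, S^z = 0)`-sector
ground states of `hubbardTorus 2 L 1 U` that are eigenvectors of every lattice translation
`fockTranslate v` — with the same `(U, δ, m, R, L₀)`. (`→`: drop the hypothesis; `←`: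
`forall_ground_of_forall_bloch_ground` at `b = m R² L²`.) For such `ψ` the pair correlation is a
function of `y - x` (`corr_add_eq_of_bloch`) and `T_R(ψ)/L² = Σ_z W_R(z) Re⟨P_0 ψ, P_z ψ⟩`
(`boxCorr_eq_card_mul_of_bloch`). Tasaki (2020) §2.1, §4.1. [folklore] -/
theorem mesoscopicPairOrder_iff_bloch : MesoscopicPairOrder ↔
    ∃ U : ℝ, 0 < U ∧ ∃ δ ∈ Set.Ioo (0:ℝ) (1 / 2), ∃ m : ℝ, 0 < m ∧ ∀ R₀ : ℕ, ∃ R : ℕ, R₀ ≤ R ∧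
      ∃ L₀ : ℕ, ∀ (L : ℕ) [NeZero L], L₀ ≤ L → Even L →
        ∀ ψ : Fock (Orb (FermionTorus 2 L)), star ψ ⬝ᵥ ψ = 1 →
          IsGroundStateInSector (hubbardTorus 2 L 1 U) (2 * ⌊(1 - δ) * (L : ℝ) ^ 2 / 2⌋₊) 0 ψ →
            (∀ v : TorusSite 2 L, ∃ c : ℂ, (fockTranslate v).val *ᵥ ψ = c • ψ) →
              m * (R : ℝ) ^ 2 ≤ (∑ x : TorusSite 2 L, ∑ y : TorusSite 2 L,
                (∏ i : Fin 2, max 0 (1 - |(((y i - x i).valMinAbs : ℤ) : ℝ)| / (R : ℝ))) *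
                  (star (localPair dWaveFormFactor L x *ᵥ ψ) ⬝ᵥ
                    (localPair dWaveFormFactor L y *ᵥ ψ)).re) / (L : ℝ) ^ 2 := by
  constructor
  · rintro ⟨U, hU, δ, hδ, m, hm, hall⟩
    refine ⟨U, hU, δ, hδ, m, hm, fun R₀ => ?_⟩
    obtain ⟨R, hR₀, L₀, hL⟩ := hall R₀
    exact ⟨R, hR₀, L₀, fun L _ hL₀ hE ψ hψ hgs _ => hL L hL₀ hE ψ hψ hgs⟩
  · rintro ⟨U, hU, δ, hδ, m, hm, hall⟩
    refine ⟨U, hU, δ, hδ, m, hm, fun R₀ => ?_⟩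
    obtain ⟨R, hR₀, L₀, hL⟩ := hall R₀
    refine ⟨R, hR₀, L₀, fun L _ hL₀ hE ψ hψ hgs => ?_⟩
    have hLpos : (0 : ℝ) < L := Nat.cast_pos.2 (Nat.pos_of_ne_zero (NeZero.ne L))
    have hL2 : (0 : ℝ) < (L : ℝ) ^ 2 := by positivity
    rw [le_div_iff₀ hL2]
    refine forall_ground_of_forall_bloch_ground L 1 U _ 0 R (m * (R : ℝ) ^ 2 * (L : ℝ) ^ 2)
      (fun φ hφ hφgs hbloch => ?_) ψ hψ hgs
    have := hL L hL₀ hE φ hφ hφgs hbloch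
    rwa [le_div_iff₀ hL2] at this

/-- **Registered form of the Bloch reduction** (sub-goal `mesoscopicPairOrderIffBloch` of crux
stmt-HubbardSuperconductivity-7331, line `Sketch`; verbatim `mesoscopicPairOrder_iff_bloch`).
[folklore] -/
theorem mesoscopicPairOrderIffBloch : Summit.HubbardSuperconductivity.HubbardSuperconductivity.Theses.FunctionFieldCertificate.MesoscopicPairOrder ↔ ∃ U : ℝ, 0 < U ∧ ∃ δ ∈ Set.Ioo (0:ℝ) (1 / 2), ∃ m : ℝ, 0 < m ∧ ∀ R₀ : ℕ, ∃ R : ℕ, R₀ ≤ R ∧ ∃ L₀ : ℕ, ∀ (L : ℕ) [NeZero L], L₀ ≤ L → Even L → ∀ ψ : Fock (Orb (FermionTorus 2 L)), star ψ ⬝ᵥ ψ = 1 → IsGroundStateInSector (hubbardTorus 2 L 1 U) (2 * ⌊(1 - δ) * (L : ℝ) ^ 2 / 2⌋₊) 0 ψ → (∀ v : TorusSite 2 L, ∃ c : ℂ, (fockTranslate v).val *ᵥ ψ = c • ψ) → m * (R : ℝ) ^ 2 ≤ (∑ x : TorusSite 2 L, ∑ y : TorusSite 2 L, (∏ i : Fin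 2, max 0 (1 - |(((y i - x i).valMinAbs : ℤ) : ℝ)| / (R : ℝ))) * (star (localPair dWaveFormFactor L x *ᵥ ψ) ⬝ᵥ (localPair dWaveFormFactor L y *ᵥ ψ)).re) / (L : ℝ) ^ 2 :=
  mesoscopicPairOrder_iff_bloch

end Summit.HubbardSuperconductivity.HubbardSuperconductivity.Theorems.FunctionFieldCertificate
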